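import Literature.AlgebraicGeometry.Resolution.LogRegularAtlasTranslate
import Literature.Geometry.PolyhedralFans.LinkedRefinementFamilyHolds
import HarnessLib

/-!
# Kato 1994 (10.4), chart step for PLACEMENT ATLASES: one set of chart monomials for every
# placement of a model family of fs charts (ÉTALE KATO programme, block EK-2)

Topic: `Literature/AlgebraicGeometry/Resolution`. Generalises `LogRegularEquivariantCharts.lean`
(translated atlases) to arbitrary PLACEMENTS. A MODEL family is a finite family of fs monoids
`P_i ⊆ ℤ^{n_i}` (`LogRegularAtlas.Model`); a PLACEMENT ATLAS of the model on a scheme `Y`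
(`LogRegularAtlas.Placements`) is a log regular Zariski fs atlas on `Y` each of whose charts is a
chart `P_{idx k} → Γ(Y, U_k)` by one of the model monoids (`Placements.toAtlas`, monoid data
DEFINITIONALLY those of the model, as for `LogRegularAtlas.translate`). Examples: the translates of
an atlas under automorphisms (equivariant Kato), the one-chart atlas of an affine étale piece of an
étale log regular atlas, the two-chart atlas of an affine piece of the fibre product of two such
pieces (étale Kato). THE POINT: for any FAMILY of placement atlases of one model — on possibly
different schemes — the regular projective subdivision of [KempfEtAl1973] Ch. II §2 Thm. 11*
(`Fan.linkedRegularRefinementFamily_holds`) of the MODEL family of chart fans with respect to the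
union of ALL links of ALL the atlases yields ONE set of chart monomials `s_i ⊆ P_i` such that on
every atlas of the family the chart ideals `(φ_k(s_{idx k}))` are compatible on overlaps and all
blow-up charts are regular (Kato (10.3)). This is the argument of
`LogRegularAtlas.exists_compatible_regular_charts` (res-L0-w81-pv-2, LogRegularResolutionGeneral.lean)
verbatim, run member by member — adapted from that file.

* `LogRegularAtlas.Model`, `Model.chartCone/chartFan` — the model family and its face fans;
* `LogRegularAtlas.Placements`, `Placements.toAtlas` — placement atlases (reducible constructor);
* `Placements.linkAt'`, `Placements.links` — the links of a family of placement atlases, pushed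
  forward to the model family (`Fan.FamilyLink.pushforward`, LogRegularAtlasTranslate.lean);
* `Placements.exists_compatible_regular_charts` — **the chart step for a family of placement
  atlases.**

References: [Kato1994] (9.8), (10.1), (10.3), (10.4); [KempfEtAl1973] Ch. II §2 Thm. 11*;
[Niziol2006] Thm. 5.8, 5.10.
-/

noncomputable section

open AlgebraicGeometry CategoryTheory TopologicalSpace Opposite
open PointedCone Literature.Geometry.PolyhedralFans
open scoped Pointwise
open Literature.Combinatorics.Optimization.HilbertBasis (toRat toRat_add toRat_zero toRat_nsmul)

namespace Literature.AlgebraicGeometry.Resolution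

universe u

namespace LogRegularAtlas

/-- A **model family of fs charts**: finitely many finitely generated, saturated, spanning
submonoids `P_i ⊆ ℤ^{n_i}` (Kato 1994 (1.5) condition (S), the monoid side only).
[cite: Kato1994, (1.5)] -/
structure Model where
  /-- index type (finite) -/
  ι : Type
  /-- finitely many members -/
  finite : Finite ι
  /-- rank of the ambient lattice of the `i`-th monoid -/
  n : ι → ℕ
  /-- the fs monoid, inside `ℤ^{n i}` -/
  P : ∀ i, AddSubmonoid (Fin (n i) → ℤ)
  /-- finitely generated -/
  fg : ∀ i, (P i).FG
  /-- saturated in `ℤ^{n i}` -/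
  saturated : ∀ i (v : Fin (n i) → ℤ) (k : ℕ), 0 < k → k • v ∈ P i → v ∈ P i
  /-- spanning `ℤ^{n i}` -/
  span_eq_top : ∀ i, Submodule.span ℤ (P i : Set (Fin (n i) → ℤ)) = ⊤

namespace Model

variable (M : Model)

/-- The cone `σ_i = P_i^∨` of the model member `i`. [cite: Kato1994, (9.6)] -/
def chartCone (i : M.ι) : PointedCone ℚ (Fin (M.n i) → ℚ) := LogBlowup.dualCone (M.P i)

/-- `σ_i` is finitely generated. [cite: Kato1994, (9.6)] -/
theorem chartCone_fg (i : M.ι) : (M.chartCone i).FG := LogBlowup.dualCone_fg (M.P i) (M.fg i)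

/-- `σ_i` is salient. [cite: Kato1994, (9.6)] -/
theorem isSalient_chartCone (i : M.ι) : IsSalient (M.chartCone i) :=
  LogBlowup.isSalient_dualCone (M.P i) (M.span_eq_top i)

/-- The face fan of `σ_i`. [cite: Kato1994, (9.6)] -/
def chartFan (i : M.ι) : Fan ℚ (Fin (M.n i) → ℚ) :=
  Fan.ofCone (M.chartCone i) (M.chartCone_fg i) (M.isSalient_chartCone i)

/-- The face fans are rational. [cite: KempfEtAl1973, Ch. I §1] -/
theorem chartFan_isRational (i : M.ι) : (M.chartFan i).IsRational := by
  classical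
  exact Fan.isRational_ofCone (M.chartCone_fg i) (M.isSalient_chartCone i)

end Model

/-- **Placements of a model family on a scheme `Y`**: finitely many affine opens `U_k` covering `Y`
with Noetherian section rings, each carrying a chart `φ_k : P_{idx k} → Γ(Y, U_k)` by one of the
model monoids, log regular at every prime (Kato Def. (2.1)), with equal stalk monoids on overlaps —
i.e. the data of a `LogRegularAtlas` on `Y` whose monoids come from the model.
[cite: Kato1994, (1.5) and Def. (2.1)] -/
structure Placements (Y : Scheme.{u}) (M : Model) where
  /-- index type of the placements (finite) -/
  κ : Type
  /-- finitely many placements -/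
  finite : Finite κ
  /-- the model member placed by `k` -/
  idx : κ → M.ι
  /-- the affine open carrying the placement -/
  U : κ → Y.affineOpens
  /-- the placements cover `Y` -/
  iSup_eq_top : ⨆ k, (U k : Y.Opens) = ⊤
  /-- Noetherian section rings -/
  isNoetherianRing : ∀ k, IsNoetherianRing Γ(Y, (U k : Y.Opens))
  /-- the chart -/
  φ : ∀ k, Multiplicative (M.P (idx k)) →* Γ(Y, (U k : Y.Opens))
  /-- log regular at every prime -/
  isLogRegularAt : ∀ k (𝔭 : Ideal Γ(Y, (U k : Y.Opens))) [𝔭.IsPrime],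
    LogChart.IsLogRegularAt (M.P (idx k)) (φ k) 𝔭
  /-- the placements define the same log structure on overlaps -/
  compat : ∀ k l (x : Y) (hk : x ∈ (U k : Y.Opens)) (hl : x ∈ (U l : Y.Opens)),
    chartStalkMonoid (U k : Y.Opens) (φ k) x hk = chartStalkMonoid (U l : Y.Opens) (φ l) x hl

variable {M : Model}

/-- **The atlas of a placement datum** (monoid data definitionally those of the model).
[cite: Kato1994, (1.5) and Def. (2.1)] -/
@[reducible] def Placements.toAtlas {Y : Scheme.{u}} (Pl : Placements Y M) : LogRegularAtlas Y where
  ι := Pl.κ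
  finite := Pl.finite
  U := Pl.U
  iSup_eq_top := Pl.iSup_eq_top
  isNoetherianRing := Pl.isNoetherianRing
  n k := M.n (Pl.idx k)
  P k := M.P (Pl.idx k)
  fg k := M.fg (Pl.idx k)
  saturated k := M.saturated (Pl.idx k)
  span_eq_top k := M.span_eq_top (Pl.idx k)
  φ := Pl.φ
  isLogRegularAt k 𝔭 _ := Pl.isLogRegularAt k 𝔭
  compat := Pl.compat

/-- The link of the placement atlas `Pl a` at a common point of two placements, pushed forward to a
link of the MODEL family of chart fans. [cite: Kato1994, (10.1)] -/
def Placements.linkAt' {A : Type*} {Y : A → Scheme.{u}} (Pl : ∀ a, Placements (Y a) M) (a : A)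
    (i j : (Pl a).κ) (y : Y a) (hi : y ∈ (((Pl a).toAtlas).U i : (Y a).Opens))
    (hj : y ∈ (((Pl a).toAtlas).U j : (Y a).Opens)) : Fan.FamilyLink M.n M.chartFan :=
  Fan.FamilyLink.pushforward (n := M.n) (Δ := M.chartFan) (Pl a).idx
    (((Pl a).toAtlas).linkAt i j y hi hj)

/-- **All links of a family of placement atlases**, on the model family. [cite: Kato1994, (10.1)] -/
def Placements.links {A : Type*} {Y : A → Scheme.{u}} (Pl : ∀ a, Placements (Y a) M) :
    Set (Fan.FamilyLink M.n M.chartFan) :=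
  {ℓ | ∃ (a : A) (i j : (Pl a).κ) (y : Y a) (hi : y ∈ (((Pl a).toAtlas).U i : (Y a).Opens))
    (hj : y ∈ (((Pl a).toAtlas).U j : (Y a).Opens)), ℓ = Placements.linkAt' Pl a i j y hi hj}

/-- `linkAt' Pl a i j y ∈ links Pl`. [cite: Kato1994, (10.1)] -/
theorem Placements.linkAt_mem_links {A : Type*} {Y : A → Scheme.{u}} (Pl : ∀ a, Placements (Y a) M)
    (a : A) (i j : (Pl a).κ) (y : Y a) (hi : y ∈ (((Pl a).toAtlas).U i : (Y a).Opens))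
    (hj : y ∈ (((Pl a).toAtlas).U j : (Y a).Opens)) :
    Placements.linkAt' Pl a i j y hi hj ∈ Placements.links Pl :=
  ⟨a, i, j, y, hi, hj, rfl⟩

variable (M)

/-- **Kato (10.4), chart step, for a FAMILY of placement atlases of one model** (on schemes
`Y a`, `a : A`): there are nonempty finite `s_i ⊆ P_i`, one per MODEL member, such that on every
atlas of the family (2) at every common point `y` of two placements `i, j` the germs of
`φ_i(s_{idx i})` and `φ_j(s_{idx j})` generate the same ideal of `𝒪_{Y_a, y}`, and (3) every
localization of every blow-up chart ring `Γ(Y_a, U_i)[(φ_i(s_{idx i}))/φ_i(b)]`, `b ∈ s_{idx i}`, is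
regular. Proof: [KempfEtAl1973] II §2 Thm. 11* for the model family w.r.t. ALL links of ALL the
atlases (`Placements.links`), a common Veronese degree, generators of the degree-`k` pieces, then
the compatibility and regularity arguments of `LogRegularAtlas.exists_compatible_regular_charts`
on each atlas (adapted from LogRegularResolutionGeneral.lean).
[cite: Kato1994, (10.4) with (9.8), (10.1), (10.3)] [cite: KempfEtAl1973, Ch. II §2 Thm. 11*] -/
theorem Placements.exists_compatible_regular_charts {A : Type*} {Y : A → Scheme.{u}}
    (Pl : ∀ a, Placements (Y a) M) :
    ∃ s : ∀ i : M.ι, Finset (M.P i),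
      (∀ i, (s i).Nonempty) ∧
      ∀ a : A,
      (∀ (i j : (Pl a).κ) (y : Y a) (hi : y ∈ (((Pl a).toAtlas).U i : (Y a).Opens))
          (hj : y ∈ (((Pl a).toAtlas).U j : (Y a).Opens)),
        (Ideal.span ((fun p : M.P ((Pl a).idx i) => ((Pl a).toAtlas).φ i (Multiplicative.ofAdd p)) ''
            (s ((Pl a).idx i) : Set (M.P ((Pl a).idx i))))).map
            ((Y a).presheaf.germ (((Pl a).toAtlas).U i : (Y a).Opens) y hi).hom =
          (Ideal.span ((fun p : M.P ((Pl a).idx j) => ((Pl a).toAtlas).φ j (Multiplicative.ofAdd p)) ''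
            (s ((Pl a).idx j) : Set (M.P ((Pl a).idx j))))).map
            ((Y a).presheaf.germ (((Pl a).toAtlas).U j : (Y a).Opens) y hj).hom) ∧
      (∀ (i : (Pl a).κ), ∀ b ∈ s ((Pl a).idx i), ∀ (𝔓 : Ideal (blowupAlgebra
          (Ideal.span ((fun p : M.P ((Pl a).idx i) => ((Pl a).toAtlas).φ i (Multiplicative.ofAdd p)) ''
            (s ((Pl a).idx i) : Set (M.P ((Pl a).idx i)))))
          (((Pl a).toAtlas).φ i (Multiplicative.ofAdd b)))) [𝔓.IsPrime],
        IsRegularLocalRing (Localization.AtPrime 𝔓)) := by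
  classical
  -- the fan data of the MODEL family, refined compatibly with the links of ALL placements
  haveI := M.finite
  haveI : Fintype M.ι := Fintype.ofFinite M.ι
  obtain ⟨l, f, hmem, hlink⟩ := Fan.linkedRegularRefinementFamily_holds M.ι M.n M.chartFan
    M.chartFan_isRational (Placements.links Pl)
  have hσmem : ∀ i, M.chartCone i ∈ (M.chartFan i).cones := fun i =>
    Fan.mem_ofCone_iff.2 (PointedCone.IsFaceOf.refl _)
  -- the refinements restricted to the top cones, and their support data
  set R : ∀ i, Fan ℚ (Fin (M.n i) → ℚ) := fun i =>
    ((M.chartFan i).starIter (l i)).restrict (M.chartCone i) with hR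
  have hsuppR : ∀ i, (R i).support = (LogBlowup.dualCone (M.P i) : Set (Fin (M.n i) → ℚ)) :=
    fun i => ((hmem i).2.2.2.2.2 (hσmem i)).1
  have hdata := fun i => ((hmem i).2.2.2.2.2 (hσmem i)).2
  choose m hm hmprop using hdata
  have hRreg : ∀ i, (R i).IsRegular := fun i ρ hρ => (hmem i).2.2.1 hρ.1
  -- a common Veronese degree
  have hver₀ := fun i => exists_veronese (R i) (m i)
  choose kf hkf hkver using hver₀
  set k : ℕ := ∏ i, kf i with hk
  have hkpos : 0 < k := Finset.prod_pos fun i _ => hkf i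
  have hver : ∀ i, ∀ j : ℕ, 0 < j → ∀ u ∈ piece (R i) (m i) (j * k),
      ∃ us : Fin j → Fin (M.n i) → ℤ, (∀ t, us t ∈ piece (R i) (m i) k) ∧ u = ∑ t, us t := by
    intro i
    have hc : 0 < ∏ j ∈ Finset.univ.erase i, kf j := Finset.prod_pos fun j _ => hkf j
    have hkeq : k = (∏ j ∈ Finset.univ.erase i, kf j) * kf i := by
      rw [hk, Finset.prod_erase_mul _ _ (Finset.mem_univ i)]
    rw [hkeq]
    exact LogBlowup.veronese_mul (R i) (m i) (hkver i) hc
  -- the chart generators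
  have hM2 := fun i => LogBlowup.exists_finset_isOrthantLike_of_isStrictSupport (M.P i) (M.fg i)
    (M.saturated i) (R i) (hsuppR i) (hRreg i) (m i) (hm i) (fun ρ hρ => (hmprop i ρ hρ).1)
    (fun ρ hρ x hx => (hmprop i ρ hρ).2.1 x hx) hkpos (hver i)
  choose s hsne hsΓ hΓs horth using hM2
  refine ⟨s, hsne, fun a => ⟨fun i j y hi hj => ?_, fun i b hb 𝔓 _ => ?_⟩⟩
  · -- (2) compatibility
    -- one inclusion, for any ordered pair of charts
    have key : ∀ (i j : (Pl a).κ) (hi : y ∈ (((Pl a).toAtlas).U i : (Y a).Opens)) (hj : y ∈ (((Pl a).toAtlas).U j : (Y a).Opens)),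
        ((fun p : M.P ((Pl a).idx i) => ((Y a).presheaf.germ (((Pl a).toAtlas).U i : (Y a).Opens) y hi).hom
            (((Pl a).toAtlas).φ i (Multiplicative.ofAdd p))) '' (s ((Pl a).idx i) : Set (M.P ((Pl a).idx i)))) *
          (chartStalkMonoid (((Pl a).toAtlas).U j : (Y a).Opens) (((Pl a).toAtlas).φ j) y hj : Set ((Y a).presheaf.stalk y)) ⊆
        ((fun p : M.P ((Pl a).idx j) => ((Y a).presheaf.germ (((Pl a).toAtlas).U j : (Y a).Opens) y hj).hom
            (((Pl a).toAtlas).φ j (Multiplicative.ofAdd p))) '' (s ((Pl a).idx j) : Set (M.P ((Pl a).idx j)))) *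
          (chartStalkMonoid (((Pl a).toAtlas).U j : (Y a).Opens) (((Pl a).toAtlas).φ j) y hj : Set ((Y a).presheaf.stalk y)) := by
      intro i j hi hj
      rintro _ ⟨_, ⟨p₀, hp₀, rfl⟩, μ, hμ, rfl⟩
      have ha' : p₀ ∈ s ((Pl a).idx i) := Finset.mem_coe.1 hp₀
      obtain ⟨q, hq⟩ := ((Pl a).toAtlas).exists_rel hi hj p₀
      -- `q` satisfies the face inequality for chart `j`
      have hqface : ∀ v ∈ LogBlowup.dualCone (((Pl a).toAtlas).P j), (∀ g ∈ ((Pl a).toAtlas).faceAt j y hj, toRat g ⬝ᵥ v = 0) →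
          (k : ℚ) * f ((Pl a).idx j) v ≤ toRat (q : Fin (M.n ((Pl a).idx j)) → ℤ) ⬝ᵥ v := by
        intro v hv hv0
        have hvt : v ∈ ((Pl a).toAtlas).faceCone j y hj := ⟨hv, hv0⟩
        set w := ((Pl a).toAtlas).linkMap hj hi v with hw_def
        have hw : w ∈ ((Pl a).toAtlas).faceCone i y hi := (((Pl a).toAtlas).linkAt j i y hj hi).mapsTo v hvt
        have hEw : ((Pl a).toAtlas).linkMap hi hj w = v := ((Pl a).toAtlas).linkMap_linkMap hj hi hvt.2
        have hpair := ((Pl a).toAtlas).linkMap_pairing hi hj hw.2 hq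
        rw [hEw] at hpair
        have hval : f ((Pl a).idx j) (((Pl a).toAtlas).linkMap hi hj w) = f ((Pl a).idx i) w :=
          (hlink _ (Placements.linkAt_mem_links Pl a i j y hi hj)).2.2 w hw
        rw [hEw] at hval
        have haw : (k : ℚ) * f ((Pl a).idx i) w ≤ toRat (p₀ : Fin (M.n ((Pl a).idx i)) → ℤ) ⬝ᵥ w := by
          have hwsupp : w ∈ (R ((Pl a).idx i)).support := by rw [hsuppR ((Pl a).idx i)]; exact hw.1
          obtain ⟨ρ, hρ, hwρ⟩ := Fan.mem_support.1 hwsupp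
          have h1 := (mem_secMonoid_iff (R ((Pl a).idx i)) (m ((Pl a).idx i))).1 (hsΓ ((Pl a).idx i) p₀ ha') ρ hρ w hwρ
          simp only at h1
          rw [sub_dotProduct, smul_dotProduct, smul_eq_mul, (hmprop ((Pl a).idx i) ρ hρ).2.2 w hwρ,
            sub_nonneg] at h1
          exact h1
        rw [hval, hpair]
        exact haw
      obtain ⟨g, hgF, hqg⟩ := LogBlowup.exists_add_mem_piece (((Pl a).toAtlas).P j) (((Pl a).toAtlas).faceAt j y hj)
        (((Pl a).toAtlas).faceAt_le j y hj) (R ((Pl a).idx j)) (hsuppR ((Pl a).idx j)) (m ((Pl a).idx j)) (f ((Pl a).idx j)) (fun ρ hρ x hx => (hmprop ((Pl a).idx j) ρ hρ).2.2 x hx)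
        k q hqface
      obtain ⟨b, hb, hz⟩ := hΓs ((Pl a).idx j) _ hqg
      have hgP : g ∈ ((Pl a).toAtlas).P j := ((Pl a).toAtlas).faceAt_le j y hj hgF
      set z : ((Pl a).toAtlas).P j := ⟨(q : Fin (M.n ((Pl a).idx j)) → ℤ) + g - b, hz⟩ with hz_def
      have hsum : q + ⟨g, hgP⟩ = b + z := Subtype.ext (by
        simp only [AddMemClass.coe_add, hz_def]; abel)
      -- germs: `φ_j(q) φ_j(g) = φ_j(b) φ_j(z)` at `y`
      set γ := ((Y a).presheaf.germ (((Pl a).toAtlas).U j : (Y a).Opens) y hj).hom with hγ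
      have hφ0 : ((Pl a).toAtlas).φ j (Multiplicative.ofAdd q) * ((Pl a).toAtlas).φ j (Multiplicative.ofAdd (⟨g, hgP⟩ : ((Pl a).toAtlas).P j)) =
          ((Pl a).toAtlas).φ j (Multiplicative.ofAdd b) * ((Pl a).toAtlas).φ j (Multiplicative.ofAdd z) := by
        have h0 : ((Pl a).toAtlas).φ j (Multiplicative.ofAdd (q + ⟨g, hgP⟩)) = ((Pl a).toAtlas).φ j (Multiplicative.ofAdd (b + z)) := by
          rw [hsum]
        rwa [ofAdd_add, ofAdd_add, map_mul, map_mul] at h0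
      have hφ : γ (((Pl a).toAtlas).φ j (Multiplicative.ofAdd q)) * γ (((Pl a).toAtlas).φ j (Multiplicative.ofAdd (⟨g, hgP⟩ : ((Pl a).toAtlas).P j))) =
          γ (((Pl a).toAtlas).φ j (Multiplicative.ofAdd b)) * γ (((Pl a).toAtlas).φ j (Multiplicative.ofAdd z)) := by
        rw [← map_mul γ, ← map_mul γ, hφ0]
      have hug : IsUnit (γ (((Pl a).toAtlas).φ j (Multiplicative.ofAdd (⟨g, hgP⟩ : ((Pl a).toAtlas).P j)))) :=
        (((Pl a).toAtlas).coe_mem_faceAt_iff hj ⟨g, hgP⟩).1 hgF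
      obtain ⟨u, hu⟩ := hq
      -- `φ_i(a)_y = φ_j(b)_y · (φ_j(z)_y · u_g⁻¹ · u⁻¹)`
      have hrew : ((Y a).presheaf.germ (((Pl a).toAtlas).U i : (Y a).Opens) y hi).hom (((Pl a).toAtlas).φ i (Multiplicative.ofAdd p₀)) =
          γ (((Pl a).toAtlas).φ j (Multiplicative.ofAdd b)) *
            (γ (((Pl a).toAtlas).φ j (Multiplicative.ofAdd z)) * ↑hug.unit⁻¹ * ↑u⁻¹) := by
        have h1 : ((Y a).presheaf.germ (((Pl a).toAtlas).U i : (Y a).Opens) y hi).hom (((Pl a).toAtlas).φ i (Multiplicative.ofAdd p₀)) =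
            γ (((Pl a).toAtlas).φ j (Multiplicative.ofAdd q)) * ↑u⁻¹ := by
          rw [← hu, Units.mul_inv_cancel_right]
        have h2 : γ (((Pl a).toAtlas).φ j (Multiplicative.ofAdd q)) =
            γ (((Pl a).toAtlas).φ j (Multiplicative.ofAdd b)) * γ (((Pl a).toAtlas).φ j (Multiplicative.ofAdd z)) * ↑hug.unit⁻¹ := by
          rw [← hφ, mul_assoc, IsUnit.mul_val_inv, mul_one]
        rw [h1, h2]; ring
      show ((Y a).presheaf.germ (((Pl a).toAtlas).U i : (Y a).Opens) y hi).hom (((Pl a).toAtlas).φ i (Multiplicative.ofAdd p₀)) * μ ∈ _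
      rw [hrew, mul_assoc]
      refine Set.mul_mem_mul ⟨b, Finset.mem_coe.2 hb, rfl⟩ ?_
      -- the second factor lies in `M_y`
      have hzM : γ (((Pl a).toAtlas).φ j (Multiplicative.ofAdd z)) ∈ chartStalkMonoid (((Pl a).toAtlas).U j : (Y a).Opens) (((Pl a).toAtlas).φ j) y hj :=
        Submonoid.mem_sup_right ⟨_, ⟨Multiplicative.ofAdd z, rfl⟩, rfl⟩
      have hunit : ∀ v : ((Y a).presheaf.stalk y)ˣ, (↑v : (Y a).presheaf.stalk y) ∈
          chartStalkMonoid (((Pl a).toAtlas).U j : (Y a).Opens) (((Pl a).toAtlas).φ j) y hj := fun v =>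
        Submonoid.mem_sup_left ((IsUnit.mem_submonoid_iff _).2 (Units.isUnit v))
      exact Submonoid.mul_mem _ (Submonoid.mul_mem _ (Submonoid.mul_mem _ hzM (hunit _)) (hunit _)) hμ
    apply ((Pl a).toAtlas).map_germ_span_eq_of_mul_chartStalkMonoid_eq hi hj
    rw [((Pl a).toAtlas).compat i j y hi hj]
    exact le_antisymm (key i j hi hj) (by rw [← ((Pl a).toAtlas).compat i j y hi hj]; exact key j i hj hi)
  · -- (3) regularity of the blow-up charts: Kato (10.3)
    haveI := ((Pl a).toAtlas).isNoetherianRing i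
    obtain ⟨b', I, hQ⟩ := horth ((Pl a).idx i) b hb
    exact LogRefinedChart.isRegularLocalRing_localization_chartAlgebra (((Pl a).toAtlas).fg i) (((Pl a).toAtlas).saturated i)
      (((Pl a).toAtlas).span_eq_top i) (fun 𝔭 _ => ((Pl a).toAtlas).isLogRegularAt i 𝔭) hQ
      (LogChart.le_blowupChartMonoid (((Pl a).toAtlas).P i) (↑(s ((Pl a).idx i))) b) (LogChart.blowupChart (((Pl a).toAtlas).P i) (((Pl a).toAtlas).φ i) (↑(s ((Pl a).idx i))) b)
      (fun p => LogChart.blowupChart_of_mem (((Pl a).toAtlas).P i) (((Pl a).toAtlas).φ i) (↑(s ((Pl a).idx i))) b p)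
      (LogChart.adjoin_range_blowupChart_eq_top (((Pl a).toAtlas).P i) (((Pl a).toAtlas).φ i) (↑(s ((Pl a).idx i))) b)
      (fun L _ g hg => blowupAlgebra_exists_extend _ _ L g (hg b)) 𝔓



end LogRegularAtlas

end Literature.AlgebraicGeometry.Resolution

end
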